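import Summits.ResolutionOfSingularities.ResolutionOfSingularities.Theorems.PurelyInseparableDim4PointZigzag
import Literature.AlgebraicGeometry.Resolution.BlowupOffCentre
import Literature.AlgebraicGeometry.Resolution.HasSNCWithOffCentre
import HarnessLib

/-!
# Purely inseparable four-folds: SURVIVAL OF A CONFIGURATION MEMBER under a blowing up away from it (brick S3 (c)
# «joint point∘coordinate chains», part 4 = item (3c) of the typ-2/typ-3 split, cell `res-dim4-pi`)

[OURS · counted 0] (D-0157 DOOR 2; desk WORD #66 (4)(c); frame `PIDim4.TerminationImpliesOrderReduction`, S3 (c);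
host item stmt-ResolutionOfSingularities-16155, helper). Nothing here proves resolution of singularities in
dimension ≥ 4 / characteristic `p` — NOT here, not anywhere in this programme.

In the JOINT TREE (configuration invariant of record, bus 22:13:48Z) a MEMBER of a configuration on `(X′, M′)` is a
closed set `c ⊆ X′` — a closed point (point regime) or the chart image of a coordinate centre `V(z, x_S)`
(coordinate regime) — blown up along its reduced ideal `vanishingIdeal c`, and carrying a ZIGZAG chart
`X′ ←φ— Y —ψ→ 𝔸⁵` reading the marked ideal as the walk's model and the centre as `(x_Λ)`. When ANOTHER member is
blown up (`π : W → X′` along `C`, `c` disjoint from `V(C)`), the member survives: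

* §1 **`member_survival_global`** — GLOBAL data transported off the centre, assembled from the tree's
  disjoint-centre API: the survivor is `π⁻¹c` with reduced ideal `vanishingIdeal (π⁻¹c) = (vanishingIdeal c)·𝒪_W`
  (`IsBlowup.comap_vanishingIdeal_of_disjoint`); it is REGULAR (`IsBlowup.isRegular_subscheme_vanishingIdeal_preimage`),
  lies in `supp (M′.transform π C)` (`IsBlowup.idealOrder_controlledTransform_of_not_mem`), and has simple normal
  crossings with the transformed boundary (`HasSNCWith.transform_comap_of_disjoint`) — BGMW Def. 3.1.3 (1)–(2)
  again, so the survivor can still be blown up later;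
* §2 `comp_eq_of_zigzag_survival` (the transported chart factors: `φ′ ≫ π = ι ≫ φ`), **`member_survival_zigzag`** —
  the ZIGZAG chart survives (typ-3 g2's construction `Y′ = φ⁻¹(X′ ∖ V(C))`, `φ′ = φ| ≫ (π|)⁻¹`, `ψ′ = ι ≫ ψ` of
  `…PointZigzag`), now with FOUR conjuncts: the controlled transform reads as the same model
  (`(πᶜ(I, μ)).comap φ′ = J.comap ψ′`), the survivor's centre reads as the same coordinate ideal
  (`(vanishingIdeal (π⁻¹c)).comap φ′ = G.comap ψ′`), the chart still COVERS the member (`π⁻¹c ⊆ range φ′`) and still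
  SEES THE WHOLE CENTRE (`V(G) ⊆ range ψ′`). Stated for any target scheme `T` of `ψ` and any ideals `I, J, G`
  (for the cell: `T = 𝔸⁵_K`, `J = hypSheaf p s.F`, `G = 𝓘Λ 4 K Λ_S`).

AI-produced formalisation, weaker than expert review. bears_on: LADDER-RESOLUTION:D157-DOOR2 (res-dim4-pi · S3 (c) joint).
-/

set_option linter.dupNamespace false -- D-0017: single-problem summit path `Summit.<S>.<S>.…` by design

noncomputable section

open CategoryTheory AlgebraicGeometry Opposite TopologicalSpace
open AlgebraicGeometry.Scheme.IdealSheafData (vanishingIdeal)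

namespace Summit.ResolutionOfSingularities.ResolutionOfSingularities.Theorems.PIDim4

open Literature.AlgebraicGeometry.Resolution

namespace Equimultiple

universe u

/-! ## §1 Global survival: regular, inside the support, snc with the transformed boundary -/

section Global

variable {X' W : Scheme.{u}} [IsLocallyNoetherian X'] [IsLocallyNoetherian W] {π : W ⟶ X'} {C : X'.IdealSheafData}

/-- **GLOBAL SURVIVAL OF A MEMBER.** `π : W → X′` a blowing up along `C`, `c ⊆ X′` a closed set disjoint from `V(C)`
whose reduced subscheme is regular, which lies in `supp M′` and has simple normal crossings with `M′.boundary`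
(itself snc with `C`, as for any admissible blow-up). Then the survivor `π⁻¹c`: has regular reduced subscheme, lies
in `supp (M′.transform π C)`, and has simple normal crossings with `(M′.transform π C).boundary` — BGMW Def. 3.1.3
(1)–(2) for the survivor as a later centre. [cite: BierstoneGrigorievMilmanWlodarczyk2011, Def. 3.1.3 (1)–(2), (4); §4 Step 2b]
[cite: StacksProject, Tag 02OS] -/
theorem member_survival_global (hπ : IsBlowup π C) (M' : MarkedIdeal X') (c : Closeds X')
    (hdisj : Disjoint (c : Set X') (C.support : Set X')) (hreg : Scheme.IsRegular (vanishingIdeal c).subscheme)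
    (hsub : (c : Set X') ⊆ M'.support) (hsncC : HasSNCWith M'.boundary C)
    (hsnc : HasSNCWith M'.boundary (vanishingIdeal c)) :
    Scheme.IsRegular (vanishingIdeal (c.preimage π.continuous)).subscheme ∧
      ((c.preimage π.continuous : Closeds W) : Set W) ⊆ (M'.transform π C).support ∧
      HasSNCWith (M'.transform π C).boundary (vanishingIdeal (c.preimage π.continuous)) := by
  refine ⟨hπ.isRegular_subscheme_vanishingIdeal_preimage c hdisj hreg, fun w hw => ?_, ?_⟩
  · have hwc : π w ∈ (c : Set X') := hw
    have hnot : π w ∉ (C.support : Set X') := fun h => hdisj.le_bot ⟨hwc, h⟩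
    change ((M'.transform π C).mult : ℕ∞) ≤ idealOrder (M'.transform π C).ideal w
    rw [MarkedIdeal.transform_ideal, MarkedIdeal.transform_mult, hπ.idealOrder_controlledTransform_of_not_mem _ _ hnot]
    exact hsub hwc
  · rw [MarkedIdeal.transform_boundary, ← hπ.comap_vanishingIdeal_of_disjoint c hdisj]
    refine hsncC.transform_comap_of_disjoint hπ hsnc ?_
    rw [Scheme.IdealSheafData.coe_support_vanishingIdeal]
    exact hdisj.symm

end Global

/-! ## §2 Zigzag survival: the chart still reads the model, reads the centre, covers the member, sees the centre -/

section Zigzag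

variable {X' W Y T : Scheme.{u}} {π : W ⟶ X'} {C : X'.IdealSheafData}

/-- The transported chart `φ′ = φ|_O ≫ (π|_O)⁻¹ ≫ ι` lies over the old one: `φ′ ≫ π = ι ≫ φ`. [cite: StacksProject, Tag 02OS] -/
theorem comp_eq_of_zigzag_survival {O : X'.Opens} [IsIso (π ∣_ O)] (φ : Y ⟶ X') :
    ((φ ∣_ O) ≫ inv (π ∣_ O) ≫ (π ⁻¹ᵁ O).ι) ≫ π = (φ ⁻¹ᵁ O).ι ≫ φ := by
  rw [Category.assoc, Category.assoc, ← morphismRestrict_ι, IsIso.inv_hom_id_assoc, morphismRestrict_ι]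

/-- **ZIGZAG SURVIVAL OF A MEMBER.** `π : W → X′` a blowing up along `C` (`W` locally Noetherian, `X′` locally
Noetherian), `c ⊆ X′` closed and disjoint from `V(C)`; a zigzag chart `X′ ←φ— Y —ψ→ T` (open immersions) with
`I.comap φ = J.comap ψ` (the marked ideal reads as the model), `(vanishingIdeal c).comap φ = G.comap ψ` (the member's
centre reads as the model centre), `c ⊆ range φ` (the chart covers the member) and `V(G) ⊆ range ψ` (the chart sees the
whole model centre). Then at `W` there is a zigzag chart `W ←φ′— Y′ —ψ′→ T` with the same four properties for
`πᶜ(I, μ)`, `vanishingIdeal (π⁻¹c)`, `π⁻¹c` and `G`. [cite: StacksProject, Tag 02OS]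
[cite: BierstoneGrigorievMilmanWlodarczyk2011, §3.2 with Lemma 8.0.3 (2)] -/
theorem member_survival_zigzag [IsLocallyNoetherian X'] [IsLocallyNoetherian W] (hπ : IsBlowup π C) (c : Closeds X')
    (hdisj : Disjoint (c : Set X') (C.support : Set X')) (φ : Y ⟶ X') [IsOpenImmersion φ] (ψ : Y ⟶ T)
    [IsOpenImmersion ψ] (I : X'.IdealSheafData) (J G : T.IdealSheafData) (hI : I.comap φ = J.comap ψ) (μ : ℕ)
    (hZ : (vanishingIdeal c).comap φ = G.comap ψ) (hcφ : (c : Set X') ⊆ Set.range φ)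
    (hsee : (G.support : Set T) ⊆ Set.range ψ) :
    ∃ (Y' : Scheme.{u}) (φ' : Y' ⟶ W) (ψ' : Y' ⟶ T) (_ : IsOpenImmersion φ') (_ : IsOpenImmersion ψ'),
      (controlledTransform π C I μ).comap φ' = J.comap ψ' ∧
        (vanishingIdeal (c.preimage π.continuous)).comap φ' = G.comap ψ' ∧
          ((c.preimage π.continuous : Closeds W) : Set W) ⊆ Set.range φ' ∧
            (G.support : Set T) ⊆ Set.range ψ' := by
  set O : X'.Opens := ⟨(C.support : Set X')ᶜ, C.support.isClosed.isOpen_compl⟩ with hO_def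
  have hO : Disjoint (O : Set X') C.support := disjoint_compl_left
  haveI : IsIso (π ∣_ O) := hπ.isIso_morphismRestrict hO
  have hcO : ∀ x : X', x ∈ (c : Set X') → x ∈ O := fun x hx h => hdisj.le_bot ⟨hx, h⟩
  -- the supports read on the chart: `φ⁻¹ c = ψ⁻¹ V(G)`
  have hsupp : ∀ y : Y, ψ y ∈ (G.support : Set T) ↔ φ y ∈ (c : Set X') := fun y => by
    have h1 : y ∈ ((G.comap ψ).support : Set Y) ↔ ψ y ∈ (G.support : Set T) := by
      rw [Scheme.IdealSheafData.support_comap]; rfl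
    have h2 : y ∈ (((vanishingIdeal c).comap φ).support : Set Y) ↔ φ y ∈ (c : Set X') := by
      rw [Scheme.IdealSheafData.support_comap]
      change φ y ∈ ((vanishingIdeal c).support : Set X') ↔ _
      rw [Scheme.IdealSheafData.coe_support_vanishingIdeal]
    rw [← h1, ← hZ, h2]
  refine ⟨(φ ⁻¹ᵁ O : Y.Opens), (φ ∣_ O) ≫ inv (π ∣_ O) ≫ (π ⁻¹ᵁ O).ι, (φ ⁻¹ᵁ O).ι ≫ ψ, inferInstance,
    inferInstance, ?_, ?_, ?_, ?_⟩
  · -- the controlled transform reads as the same model (typ-3 g2's computation)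
    rw [Scheme.IdealSheafData.comap_comp, Scheme.IdealSheafData.comap_comp, comap_controlledTransform_ι_of_disjoint C I hO,
      ← Scheme.IdealSheafData.comap_comp _ (inv (π ∣_ O)), IsIso.inv_hom_id, Scheme.IdealSheafData.comap_id,
      ← Scheme.IdealSheafData.comap_comp, morphismRestrict_ι, Scheme.IdealSheafData.comap_comp, hI,
      ← Scheme.IdealSheafData.comap_comp]
  · -- the survivor's centre reads as the same coordinate ideal
    rw [← hπ.comap_vanishingIdeal_of_disjoint c hdisj, ← Scheme.IdealSheafData.comap_comp,
      comp_eq_of_zigzag_survival φ, Scheme.IdealSheafData.comap_comp, hZ, ← Scheme.IdealSheafData.comap_comp]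
  · -- the chart still covers the member
    intro w hw
    have hwc : π w ∈ (c : Set X') := hw
    obtain ⟨y, hy⟩ := hcφ hwc
    have hyO : y ∈ φ ⁻¹ᵁ O := by
      change φ y ∈ O
      rw [hy]
      exact hcO _ hwc
    have hwO : w ∈ π ⁻¹ᵁ O := hcO _ hwc
    refine ⟨⟨y, hyO⟩, ?_⟩
    have h1 : (φ ∣_ O) ⟨y, hyO⟩ = (π ∣_ O) ⟨w, hwO⟩ := by
      apply Subtype.ext
      rw [morphismRestrict_base_coe, morphismRestrict_base_coe]
      exact hy
    rw [Scheme.Hom.comp_apply, Scheme.Hom.comp_apply, h1, ← Scheme.Hom.comp_apply (π ∣_ O), IsIso.hom_inv_id]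
    rfl
  · -- the chart still sees the whole centre
    intro v hv
    obtain ⟨y, hy⟩ := hsee hv
    have hyc : φ y ∈ (c : Set X') := (hsupp y).mp (by rw [hy]; exact hv)
    exact ⟨⟨y, hcO _ hyc⟩, by rw [Scheme.Hom.comp_apply]; exact hy⟩

end Zigzag

end Equimultiple

end Summit.ResolutionOfSingularities.ResolutionOfSingularities.Theorems.PIDim4

end
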